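import Literature.NumberTheory.GaloisRepresentations.LubinTateUnramifiedNormalBasis
import Literature.NumberTheory.GaloisRepresentations.LubinTateColemanRelativeBaseNormLawsTwo
import HarnessLib

/-!
# `Gal(E/F) = ⟨φ⟩` for unramified `E`, the trace as a sum over Frobenius powers, and the SURJECTIVITY of the unramified trace
# `Tr_{E/F}(𝒪_E) = 𝒪_F`

Serre, *Local Fields* (1979), Ch. I §4 Prop. 10, Ch. III §4 / Ch. V §2 (unramified extensions: Galois group generated by the Frobenius,
trace surjective on integers), for a finite Galois `E ⊆ F^{nr}` over a non-archimedean local field `F` in the currency of the tree's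
Lubin–Tate files.  These are the inputs for assembling the INVERSE LIMIT over the unramified layers `k′` of the two-variable tower
(de Shalit III §1.3; the transition maps on coordinates are traces, `relUnitCoordTwo_baseNorm`).  Everything PROVED (0 sorry, no named facts):

* `exists_eq_restrictNormal_pow` — every `σ ∈ Gal(E/F)` is a power of `φ = σ₀|_E` (`σ₀` an arithmetic Frobenius);
* ★ `orderOf_restrictNormal_eq_finrank` — `φ|_E` has order `[E:F]`; `bijective_restrictNormal_pow` — `i ↦ φ^i`, `i < [E:F]`, is a
  bijection onto `Gal(E/F)`;
* ★ `algebraMap_trace_eq_sum_restrictNormal_pow` — `Tr_{E/F}(x) = Σ_{i<[E:F]} φ^i x`;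
* ★★ `exists_trace_coe_eq` — **`Tr_{E/F} : 𝒪_E → 𝒪_F` is onto**: with an integral normal basis `(φ^iθ)` one has `Tr(θ) = Σ_i φ^iθ`, whose
  coordinates are all `1`, so `Tr(θ) ∈ 𝒪_F^×` (`LubinTateUnramifiedNormalBasis`).

## References

* J.-P. Serre, *Local Fields* (1979), Ch. I §4 Prop. 10; Ch. V §2 (trace and norm in unramified extensions). [SerreLocalFields1979]
* E. de Shalit, *Iwasawa theory of elliptic curves with complex multiplication* (1987), Ch. I §3.8 (16), Ch. III §1.3. [deShalit1987]
-/

noncomputable section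

namespace Literature.NumberTheory.GaloisRepresentations

section UnramifiedTrace

open GaloisRepresentations.IsNonarchimedeanLocalField LubinTate ValuativeRel Field

variable {F : Type} [Field F] [ValuativeRel F] [TopologicalSpace F] [IsNonarchimedeanLocalField F]

attribute [local instance] ltNormUniformSpace ltNormIsUniformAddGroup rk1 nF nE fintypeResidueField

variable (E : IntermediateField F (AlgebraicClosure F)) [FiniteDimensional F E] [Normal F E]

/-! ### `Gal(E/F)` is generated by the Frobenius -/

omit [ValuativeRel F] [TopologicalSpace F] [IsNonarchimedeanLocalField F] [FiniteDimensional F E] in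
/-- `((σ₀|_E)^k x : F̄) = σ₀^k • x`. [cite: SerreLocalFields1979, Ch. I §7 Prop. 20] -/
theorem coe_restrictNormal_pow_apply (σ₀ : absoluteGaloisGroup F) (k : ℕ) (x : E) :
    (((((absoluteGaloisGroup.toAlgEquiv F σ₀).restrictNormal E) ^ k) x : E) : AlgebraicClosure F) =
      (σ₀ ^ k) • ((x : E) : AlgebraicClosure F) := by
  induction k with
  | zero => rw [pow_zero, pow_zero, AlgEquiv.one_apply, one_smul]
  | succ k ih => rw [pow_succ', AlgEquiv.mul_apply, coe_restrictNormal_apply, ih, pow_succ', mul_smul]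

/-- **Every `σ ∈ Gal(E/F)` is a power of the Frobenius `φ = σ₀|_E`** for `E ⊆ F^{nr}` finite normal and `σ₀` an arithmetic Frobenius.
[cite: SerreLocalFields1979, Ch. I §4 Prop. 10] -/
theorem exists_eq_restrictNormal_pow (hE : E ≤ maxUnramified F) {σ₀ : absoluteGaloisGroup F} (hσ₀ : IsAbsArithFrob σ₀)
    (σ : E ≃ₐ[F] E) : ∃ a : ℕ, σ = ((absoluteGaloisGroup.toAlgEquiv F σ₀).restrictNormal E) ^ a := by
  obtain ⟨χ, hχ⟩ := AlgEquiv.restrictNormalHom_surjective (F := F) (E := AlgebraicClosure F) (K₁ := E) σ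
  obtain ⟨a, ha⟩ := exists_forall_smul_eq_pow_smul E hE hσ₀ ((absoluteGaloisGroup.toAlgEquiv F).symm χ)
  refine ⟨a, AlgEquiv.ext fun x => Subtype.ext ?_⟩
  rw [coe_restrictNormal_pow_apply, ← ha, ← coe_restrictNormal_apply E, MulEquiv.apply_symm_apply]
  exact congrArg (fun ρ : E ≃ₐ[F] E => ((ρ x : E) : AlgebraicClosure F)) hχ.symm

variable [IsGalois F E]

/-- ★ **The Frobenius `φ|_E` has order `[E:F]`** (`Gal(E/F) = ⟨φ|_E⟩` is cyclic of order `[E:F]`).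
[cite: SerreLocalFields1979, Ch. I §4 Prop. 10] -/
theorem orderOf_restrictNormal_eq_finrank (hE : E ≤ maxUnramified F) {σ₀ : absoluteGaloisGroup F} (hσ₀ : IsAbsArithFrob σ₀) :
    orderOf ((absoluteGaloisGroup.toAlgEquiv F σ₀).restrictNormal E) = Module.finrank F E := by
  classical
  letI : Fintype (E ≃ₐ[F] E) := Fintype.ofFinite _
  rw [orderOf_eq_card_of_forall_mem_zpowers (fun σ => ?_), IsGalois.card_aut_eq_finrank]
  obtain ⟨a, ha⟩ := exists_eq_restrictNormal_pow E hE hσ₀ σ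
  exact ⟨a, by rw [ha]; simp⟩

/-- **`i ↦ φ^i` (`i < [E:F]`) is a bijection onto `Gal(E/F)`.** [cite: SerreLocalFields1979, Ch. I §4 Prop. 10] -/
theorem bijective_restrictNormal_pow (hE : E ≤ maxUnramified F) {σ₀ : absoluteGaloisGroup F} (hσ₀ : IsAbsArithFrob σ₀) :
    Function.Bijective fun i : Fin (Module.finrank F E) => ((absoluteGaloisGroup.toAlgEquiv F σ₀).restrictNormal E) ^ (i : ℕ) := by
  classical
  letI : Fintype (E ≃ₐ[F] E) := Fintype.ofFinite _
  have hinj : Function.Injective fun i : Fin (Module.finrank F E) =>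
      ((absoluteGaloisGroup.toAlgEquiv F σ₀).restrictNormal E) ^ (i : ℕ) := by
    intro i j hij
    apply Fin.ext
    have h := pow_injOn_Iio_orderOf (x := (absoluteGaloisGroup.toAlgEquiv F σ₀).restrictNormal E)
      (by rw [Set.mem_Iio, orderOf_restrictNormal_eq_finrank E hE hσ₀]; exact i.2)
      (by rw [Set.mem_Iio, orderOf_restrictNormal_eq_finrank E hE hσ₀]; exact j.2) hij
    exact h
  refine hinj.bijective_of_nat_card_le (le_of_eq ?_)
  rw [IsGalois.card_aut_eq_finrank, Nat.card_eq_fintype_card, Fintype.card_fin]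

/-- ★ **`Tr_{E/F}(x) = Σ_{i < [E:F]} φ^i(x)`** for `E ⊆ F^{nr}` finite Galois. [cite: SerreLocalFields1979, Ch. V §2] -/
theorem algebraMap_trace_eq_sum_restrictNormal_pow (hE : E ≤ maxUnramified F) {σ₀ : absoluteGaloisGroup F} (hσ₀ : IsAbsArithFrob σ₀)
    (x : E) :
    algebraMap F E (Algebra.trace F E x) =
      ∑ i : Fin (Module.finrank F E), (((absoluteGaloisGroup.toAlgEquiv F σ₀).restrictNormal E) ^ (i : ℕ)) x := by
  classical
  rw [trace_eq_sum_automorphisms]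
  exact ((bijective_restrictNormal_pow E hE hσ₀).sum_comp (fun σ : E ≃ₐ[F] E => σ x)).symm

/-! ### The unramified trace is onto on integers -/

variable {π : 𝒪[F]} (hπ : (valuation F).IsUniformizer (π : F))

include hπ in
set_option maxHeartbeats 800000 in
/-- ★★ **`Tr_{E/F}(𝒪_E) = 𝒪_F` for `E ⊆ F^{nr}` finite Galois**: for every `a ∈ 𝒪_F` there is `c ∈ 𝒪_E` with `Tr_{E/F}(c) = a`.  With an
integral normal basis `b_i = φ^iθ` (`LubinTateUnramifiedNormalBasis`), `Tr(θ) = Σ_i b_i` has all coordinates `1`, hence is a UNIT `t` of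
`𝒪_F`, and `Tr(a t⁻¹ θ) = a`. [cite: SerreLocalFields1979, Ch. V §2] -/
theorem exists_trace_coe_eq (hE : E ≤ maxUnramified F) {σ₀ : absoluteGaloisGroup F} (hσ₀ : IsAbsArithFrob σ₀) (a : 𝒪[F]) :
    ∃ c : unitBall E, Algebra.trace F E (c : E) = (a : F) := by
  classical
  obtain ⟨φ, hφ⟩ : ∃ φ : unitBall E →+* unitBall E, φ = (frobUnitBall E σ₀ : unitBall E →+* unitBall E) := ⟨_, rfl⟩
  have hφa : ∀ t : 𝒪[F], φ (algebraMap 𝒪[F] (unitBall E) t) = algebraMap 𝒪[F] (unitBall E) t := fun t => by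
    rw [hφ]; exact unitBallEquiv_algebraMap E _ t
  have hφpow : ∀ c : unitBall E, φ c - c ^ residueFieldCard F ∈ Ideal.span {algebraMap 𝒪[F] (unitBall E) π} := fun c => by
    rw [hφ]; exact unitBallEquiv_sub_pow_mem hπ E hE hσ₀ _ (coe_restrictNormal_apply E σ₀) c
  obtain ⟨θ, b, hb⟩ := exists_basis_eq_pow_apply hπ E hE hφa hφpow
  -- `Tr θ = Σ_i b_i`
  obtain ⟨s, hs⟩ : ∃ s : unitBall E, s = ∑ i : Fin (Module.finrank F E), b i := ⟨_, rfl⟩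
  have htr : algebraMap F E (Algebra.trace F E (θ : E)) = (s : E) := by
    rw [algebraMap_trace_eq_sum_restrictNormal_pow E hE hσ₀, hs, AddSubmonoidClass.coe_finsetSum]
    refine Finset.sum_congr rfl fun i _ => ?_
    rw [hb, hφ, coe_frobUnitBall_pow_apply]
  -- `Tr θ ∈ 𝒪_F`
  obtain ⟨t, ht⟩ : ∃ t : 𝒪[F], algebraMap 𝒪[F] F t = Algebra.trace F E (θ : E) :=
    IsIntegrallyClosed.algebraMap_eq_of_integral
      (Algebra.isIntegral_trace ((isIntegral_iff_norm_le_one E (θ : E)).mpr ((mem_unitBall_iff E).mp θ.2)))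
  have hst : s = algebraMap 𝒪[F] (unitBall E) t := by
    apply Subtype.ext
    rw [algebraMap_integer_apply, ← htr, ← ht]
    rfl
  -- all coordinates of `s` are `1`, so `t` is a unit
  have hcoord : ∀ j, b.repr s j = t * b.repr 1 j := fun j => by
    rw [hst, Algebra.algebraMap_eq_smul_one, map_smul, Finsupp.smul_apply, smul_eq_mul]
  have hone : ∀ j, b.repr s j = 1 := fun j => by
    rw [hs, map_sum, Finset.sum_apply', Finset.sum_eq_single j]
    · rw [Module.Basis.repr_self, Finsupp.single_eq_same]
    · intro i _ hij; rw [Module.Basis.repr_self, Finsupp.single_eq_of_ne hij.symm]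
    · intro h; exact absurd (Finset.mem_univ j) h
  have hdpos : 0 < Module.finrank F E := Module.finrank_pos
  have htu : IsUnit t := by
    by_contra hnu
    have hmax : t ∈ 𝓂[F] := (IsLocalRing.mem_maximalIdeal _).mpr hnu
    have h1 : (1 : 𝒪[F]) ∈ 𝓂[F] := by
      rw [← hone ⟨0, hdpos⟩, hcoord]
      exact Ideal.mul_mem_right _ _ hmax
    exact (Ideal.ne_top_iff_one _).mp (Ideal.IsMaximal.ne_top inferInstance) h1
  obtain ⟨w, hw⟩ := htu.exists_left_inv
  -- `Tr((a w) • θ) = a w t = a`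
  refine ⟨(a * w) • θ, ?_⟩
  have e : (((a * w) • θ : unitBall E) : E) = ((a * w : 𝒪[F]) : F) • (θ : E) := by
    rw [Algebra.smul_def, Subring.coe_mul, algebraMap_integer_apply, Algebra.smul_def]
  rw [e, map_smul, smul_eq_mul, ← ht]
  change ((a * w : 𝒪[F]) : F) * ((t : 𝒪[F]) : F) = (a : F)
  rw [← MulMemClass.coe_mul, mul_assoc, hw, mul_one]

end UnramifiedTrace

end Literature.NumberTheory.GaloisRepresentations
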